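import Summits.ResolutionOfSingularities.ResolutionOfSingularities.Theorems.EquisingularLiftEquisingularLiftNatLineBundleSectionHom
import HarnessLib

/-!
# [OURS · L1 W4.5(b) · EL♮(3)] T-DIRLIFT-UP, route C, brick C1b — THE COCYCLE OF A LOCALLY SPLIT LINE OF SECTIONS: locally proportional
# sections `w_z ∈ Γ(G, U_z)` with functionals `ρ_z(w_z) = 1` define the unit cocycle `g_{zz'} = ρ_z(w_{z'})`, the family is twisted by it,
# and the cocycle line bundle maps to `G`, locally split — T-P1VB's `(L₀, ι₀, hsplit)`

Crux chain w45b (cell `res-hironaka`, slot W4.5(b)), working crux **EL♮** = stmt-ResolutionOfSingularities-20038, child **EL♮(3)** =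
stmt-ResolutionOfSingularities-20148, route EquisingularLift, line `sections`; object **T-DIRLIFT-UP** (the P1VB glue of a direction round,
res-L1-w45b-plan-1 RULINGS 19:13:00Z / 19:14:55Z: ROUTE C; spec `L/res-D-pv-051/TARGET-DIRLIFT.sig.md` 7aab4520d07b2a47, entry text
`TARGET-DIRLIFT-UP.sig.lean` 79182c5cfea32e6c), brick **C1b** after C1a (…NatLineBundleSectionHom p562805): the direction generators
`w_z = ᾱ_z ℓ̄_z + β̄_z m̄_z ∈ Γ(g^*F, U_z)` of a direction line are LOCALLY PROPORTIONAL (two adapted frames describe the same line — C1 ring core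
p561783 `exists_unit_of_coords_eq`) and carry functionals with `ρ_z(w_z) = 1` (unimodular coordinates, C1a `exists_functional_of_unimodular_coords`);
this file turns exactly that data into T-P1VB AnyBase's inputs. HONEST FRAMING: OURS; NOT a statement of any manuscript; AI-written, weaker than
expert review. No `sorry`; standard axioms. ONE definition (`proportionalCocycle`, the unit cocycle). `--supports stmt-ResolutionOfSingularities-20148 --as helper`.

WHAT (namespace `…Cruxes.EquisingularLiftNat.P1VB`; any scheme `Y`, any `𝒪_Y`-module `G`).
* `factor_eq` / `exists_factor` — if `w_{z'}| = u • w_z|` then `u = ρ_z(w_{z'}|)`: the proportionality factor IS `ρ_z(w_{z'})`.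
* **`proportionalCocycle`** — the `UnitCocycle` with `U := U`, `g_{z z'} := ρ_z(w_{z'}|)` on `V ≤ U_z ⊓ U_{z'}`: restriction-compatible by
  naturality of `ρ_z`, `g_{zz} = ρ_z(w_z) = 1`, and `g_{zz'} g_{z'z''} = g_{zz''}` because `w_{z''} = g_{z'z''} w_{z'}`.
* `twisted_proportionalCocycle` — **the family is twisted by its cocycle**: `w_{z'}| = g_{zz'} • w_z|` (C1a's hypothesis).
* **`exists_subLineBundle_of_proportional`** — T-P1VB's input block: `∃ ι : lineBundle (proportionalCocycle …) ⟶ G` with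
  `ι|_{U_z} = (s ↦ s_z · w_z)` for all `z` and `hsplit` (`∀ y, ∃ W ∋ y, ∃ r, ι|_W ≫ r = 𝟙`) — by C1a.

References: R. Hartshorne, *Algebraic Geometry* (1977), II Ex. 1.22, III Ex. 4.5; The Stacks Project, Tag 00AK — through the tree
(Literature `Modules/UnitCocycle`, `Modules/LineBundleOfCocycle`, `Modules/SheafHom`; C1a p562805).
-/

noncomputable section

open CategoryTheory AlgebraicGeometry Opposite TopologicalSpace
open Literature.AlgebraicGeometry.Modules Literature.AlgebraicGeometry.Motives

set_option linter.dupNamespace false -- mandated namespace `Summit.<Summit>.<Problem>` of this single-conjunct summit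

namespace Summit.ResolutionOfSingularities.ResolutionOfSingularities.Cruxes.EquisingularLiftNat.P1VB

universe u

variable {Y : Scheme.{u}} {G : Y.Modules} (U : Y → Y.Opens) (hU : ∀ z, z ∈ U z) (w : ∀ z, Γ(G, U z))
  (ρ : ∀ z, G.over (U z) ⟶ (unitModule Y).over (U z))
  (hρ : ∀ z, @Eq Γ(Y, U z) (appLE (ρ z) (𝟙 (U z)) (w z)) 1)
  (hprop : ∀ (z z' : Y) (V : Y.Opens) (hz : V ≤ U z) (hz' : V ≤ U z'),
    ∃ u : Γ(Y, V), G.presheaf.map (homOfLE hz').op (w z') = u • G.presheaf.map (homOfLE hz).op (w z))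

/-! ## 1. The proportionality factor is `ρ_z(w_{z'})` -/

include hρ in
/-- If `w_{z'}| = u • w_z|` then `u = ρ_z(w_{z'}|)` (apply `ρ_z`; `ρ_z(w_z) = 1`). [folklore] -/
theorem factor_eq (z z' : Y) (V : Y.Opens) (hz : V ≤ U z) (hz' : V ≤ U z') (u : Γ(Y, V))
    (hu : G.presheaf.map (homOfLE hz').op (w z') = u • G.presheaf.map (homOfLE hz).op (w z)) :
    @Eq Γ(Y, V) (appLE (ρ z) (homOfLE hz) (G.presheaf.map (homOfLE hz').op (w z'))) u := by
  rw [hu, appLE_smul_right]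
  -- `ρ_z(w_z|_V) = ρ_z(w_z)|_V = 1`
  have h := appLE_map (ρ z) (𝟙 (U z)) (homOfLE hz) (w z)
  rw [Category.comp_id] at h
  have h1 : @Eq Γ(Y, V) (appLE (ρ z) (homOfLE hz) (G.presheaf.map (homOfLE hz).op (w z))) 1 := by
    have h' : @Eq Γ(Y, V) (appLE (ρ z) (homOfLE hz) (G.presheaf.map (homOfLE hz).op (w z)))
        (Y.presheaf.map (homOfLE hz).op (appLE (ρ z) (𝟙 (U z)) (w z) : Γ(Y, U z))) := h
    rw [h', hρ z, map_one]
  have h2 : ∀ t : Γ(Y, V), @Eq Γ(Y, V) (appLE (ρ z) (homOfLE hz) (G.presheaf.map (homOfLE hz).op (w z))) t →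
      (u • appLE (ρ z) (homOfLE hz) (G.presheaf.map (homOfLE hz).op (w z)) : Γ(unitModule Y, V)) = u * t := by
    intro t ht; rw [← ht]; rfl
  rw [h2 1 h1, mul_one]

include hρ hprop in
/-- **The proportionality factor**: `w_{z'}|_V = u • w_z|_V` with `u = ρ_z(w_{z'}|_V)`. [folklore] -/
theorem exists_factor (z z' : Y) (V : Y.Opens) (hz : V ≤ U z) (hz' : V ≤ U z') :
    ∃ u : Γ(Y, V), @Eq Γ(Y, V) (appLE (ρ z) (homOfLE hz) (G.presheaf.map (homOfLE hz').op (w z'))) u ∧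
      G.presheaf.map (homOfLE hz').op (w z') = u • G.presheaf.map (homOfLE hz).op (w z) := by
  obtain ⟨u, hu⟩ := hprop z z' V hz hz'
  exact ⟨u, factor_eq U w ρ hρ z z' V hz hz' u hu, hu⟩

/-! ## 2. The cocycle -/

/-- **The unit cocycle of a locally split line of sections** `w_z ∈ Γ(G, U_z)` with functionals `ρ_z(w_z) = 1`, locally proportional on
overlaps: `g_{zz'} := ρ_z(w_{z'}|_V)` (Hartshorne III Ex. 4.5: the transition functions of the line `𝒪 · w`). [cite: Hartshorne1977, III Ex. 4.5] -/
def proportionalCocycle : UnitCocycle Y where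
  U := U
  mem := hU
  g z z' V hz hz' := appLE (ρ z) (homOfLE hz) (G.presheaf.map (homOfLE hz').op (w z'))
  map_g z z' V V' hz hz' i := by
    have h := appLE_map (ρ z) (homOfLE hz) (homOfLE i) (G.presheaf.map (homOfLE hz').op (w z'))
    rw [presheaf_map_map] at h
    change Y.presheaf.map (homOfLE i).op (appLE (ρ z) (homOfLE hz) (G.presheaf.map (homOfLE hz').op (w z'))) =
      appLE (ρ z) (homOfLE (i.trans hz)) (G.presheaf.map (homOfLE (i.trans hz')).op (w z'))
    rw [Subsingleton.elim (homOfLE (i.trans hz)) (homOfLE i ≫ homOfLE hz),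
      Subsingleton.elim (homOfLE (i.trans hz')) (homOfLE i ≫ homOfLE hz')]
    exact h.symm
  g_mul z z' z'' V hz hz' hz'' := by
    -- `ρ_z(w_{z''}) = ρ_z(t • w_{z'}) = t · ρ_z(w_{z'})`, `t = ρ_{z'}(w_{z''})`
    obtain ⟨t, ht, hw⟩ := exists_factor U w ρ hρ hprop z' z'' V hz' hz''
    dsimp only
    rw [ht, hw, appLE_smul_right]
    exact mul_comm _ _
  g_self z V hz :=
    factor_eq U w ρ hρ z z V hz hz 1 (by rw [one_smul])

/-- The cover of `proportionalCocycle` is `U`. [folklore] -/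
@[simp] theorem proportionalCocycle_U : (proportionalCocycle U hU w ρ hρ hprop).U = U := rfl

/-- The transition functions of `proportionalCocycle` are `ρ_z(w_{z'}|)`. [folklore] -/
theorem proportionalCocycle_g (z z' : Y) (V : Y.Opens) (hz : V ≤ U z) (hz' : V ≤ U z') :
    (proportionalCocycle U hU w ρ hρ hprop).g z z' V hz hz' =
      appLE (ρ z) (homOfLE hz) (G.presheaf.map (homOfLE hz').op (w z')) := rfl

/-- **The family is twisted by its cocycle** (C1a's hypothesis `hw`). [folklore] -/
theorem twisted_proportionalCocycle (z z' : Y) (V : Y.Opens) (hz : V ≤ U z) (hz' : V ≤ U z') :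
    G.presheaf.map (homOfLE hz').op (w z') =
      (proportionalCocycle U hU w ρ hρ hprop).g z z' V hz hz' • G.presheaf.map (homOfLE hz).op (w z) := by
  obtain ⟨u, hu, hw⟩ := exists_factor U w ρ hρ hprop z z' V hz hz'
  have hg : (proportionalCocycle U hU w ρ hρ hprop).g z z' V hz hz' = u := hu
  rw [hg]
  exact hw

/-! ## 3. T-P1VB's input block -/

/-- **C1b: a locally split line of sections is a locally split sub-line-bundle.** For sections `w_z ∈ Γ(G, U_z)` (`z ∈ U_z`), functionals
`ρ_z : G|_{U_z} → 𝒪|_{U_z}` with `ρ_z(w_z) = 1`, locally proportional on overlaps, there is `ι : L ⟶ G` from the cocycle line bundle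
`L = lineBundle (proportionalCocycle …)` with `ι|_{U_z} = (s ↦ s_z · w_z)` for every `z`, and `ι` is locally split
(T-P1VB AnyBase's `hsplit` shape verbatim). [cite: Hartshorne1977, II Ex. 1.22] [cite: StacksProject, Tag 00AK] -/
theorem exists_subLineBundle_of_proportional :
    ∃ ι : lineBundle (proportionalCocycle U hU w ρ hρ hprop) ⟶ G,
      (∀ z, (SheafOfModules.overFunctor _ (U z)).map ι =
        (proportionalCocycle U hU w ρ hρ hprop).lineBundleTrivInv z ≫ smulSection (w z)) ∧
      ∀ y : Y, ∃ (W : Y.Opens) (_ : y ∈ W) (r : G.over W ⟶ (lineBundle (proportionalCocycle U hU w ρ hρ hprop)).over W),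
        (SheafOfModules.overFunctor _ W).map ι ≫ r = 𝟙 _ := by
  obtain ⟨ι, hι⟩ := exists_hom_lineBundle_of_twisted (proportionalCocycle U hU w ρ hρ hprop) w
    (twisted_proportionalCocycle U hU w ρ hρ hprop)
  exact ⟨ι, hι, hsplit_of_eval_one (proportionalCocycle U hU w ρ hρ hprop) w ι hι (fun z => ⟨ρ z, hρ z⟩)⟩

end Summit.ResolutionOfSingularities.ResolutionOfSingularities.Cruxes.EquisingularLiftNat.P1VB

end
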